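/-
Origin: written from primary sources — S. Helgason, *Differential Geometry, Lie Groups, and Symmetric Spaces* (1978)
Ch. VIII §7 (isotropy representation of a hermitian symmetric space; weights of `𝔭₊`); A. Borel, *Automorphic forms on
SL₂(ℝ)* (1997) §5.14. Adapted: no. A two-line computation joining `UnitBallIsotropyCharacter` (`isotropyDetChar`,
`det D(k)(x₀) = det k / k₂₂³`) with the diagonal torus `diagU a b c` of `UnitaryGroupTorusCharacters`: the torus
weights of the `K`-type `∧²𝔭₊` of `U(2,1)` are `(1, 1; -2)`. Kernel only.
-/
import Literature.Geometry.ComplexHyperbolic.UnitBallIsotropyCharacter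
import Literature.Geometry.ComplexHyperbolic.UnitaryGroupTorusCharacters
import HarnessLib

/-!
# Torus weights of `∧²𝔭₊`: `det D(diag(a,b,c))(x₀) = a b c⁻²`

* `diagU_smul_x₀` — the diagonal torus fixes the base point `x₀ = 0` of the ball, `diagU_mem_stabilizer`,
  `diagK a b c : stabilizer U21 x₀`;
* **`isotropyDetChar_diagK`** — `isotropyDetChar (diag(a,b,c)) = a · b · c⁻²` in `ℂˣ`, i.e. the torus weights of
  `∧²𝔭₊` (the character `κ` of PerL's isolation step at the distinguished place) are `(1, 1; -2)`; as `ℂ`-values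
  `coe_isotropyDetChar_diagK : … = a * b / c ^ 2`.

Provenance / use (Hodge-CM model-construction cell, D5-arch bookkeeping): compared with gen-2's `(m, m; m)`-shaped
`det^m` characters (`UnitaryGroupTorusCharactersIntegral`), this fixes the three integers the `κ`-isotypy imposes on
the compact torus at `ι₁`; the `K`-type count of PerL Lemma 3.5 / [Ichino2022] §4.1 is read against them.
-/

noncomputable section

open Matrix MulAction

namespace Literature.Geometry.ComplexHyperbolic

namespace BallModel

/-- The vector `diag(a,b,c) · (0,0,1)`: its last coordinate is `c`, the first two vanish. [folklore] -/
theorem W3_diagU_x₀ (a b c : Circle) (k : Fin 3) :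
    W3 (diagU a b c) x₀ k = if k = 2 then (c : ℂ) else 0 := by
  rw [W3_apply, mat_diagU, x₀_val, Pi.zero_apply, Pi.zero_apply, mul_zero, mul_zero, zero_add, zero_add]
  fin_cases k <;> simp [diagMat3]

/-- **The diagonal torus fixes the base point** `x₀ = 0`. [folklore] -/
theorem diagU_smul_x₀ (a b c : Circle) : diagU a b c • x₀ = x₀ := by
  apply Ball.ext
  intro i
  rw [smul_val, W3_diagU_x₀, W3_diagU_x₀, x₀_val, Pi.zero_apply]
  fin_cases i <;> simp

/-- `diag(a,b,c) ∈ Stab(x₀)`. [folklore] -/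
theorem diagU_mem_stabilizer (a b c : Circle) : diagU a b c ∈ stabilizer U21 x₀ :=
  mem_stabilizer_iff.mpr (diagU_smul_x₀ a b c)

/-- The diagonal torus element as an element of the isotropy group `K = Stab(x₀)`. [folklore] -/
def diagK (a b c : Circle) : stabilizer U21 x₀ := ⟨diagU a b c, diagU_mem_stabilizer a b c⟩

/-- Its underlying element of `U(2,1)`. [folklore] -/
@[simp] theorem coe_diagK (a b c : Circle) : (diagK a b c : U21) = diagU a b c := rfl

/-- `diagK` is multiplicative. [folklore] -/
theorem diagK_mul (a b c a' b' c' : Circle) : diagK a b c * diagK a' b' c' = diagK (a * a') (b * b') (c * c') :=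
  Subtype.ext (diagU_mul a b c a' b' c')

/-- `det diag(a,b,c) = a b c`. [folklore] -/
theorem det_mat_diagU (a b c : Circle) : (mat (diagU a b c)).det = a * b * c := by
  rw [mat_diagU]
  simp [diagMat3, Matrix.det_fin_three]

/-- The `(2,2)` entry of `diag(a,b,c)` is `c`. [folklore] -/
theorem mat_diagU_two_two (a b c : Circle) : mat (diagU a b c) 2 2 = c := rfl

/-- **Torus weights of `∧²𝔭₊` are `(1, 1; -2)`**: `det D(diag(a,b,c))(x₀) = a b / c²` as a complex number. [folklore] -/
theorem coe_isotropyDetChar_diagK (a b c : Circle) :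
    (isotropyDetChar (diagK a b c) : ℂ) = (a : ℂ) * b / (c : ℂ) ^ 2 := by
  rw [coe_isotropyDetChar_eq, coe_diagK, det_mat_diagU, mat_diagU_two_two]
  have hc : (c : ℂ) ≠ 0 := Circle.coe_ne_zero c
  field_simp

/-- The same in `ℂˣ`: `isotropyDetChar (diag(a,b,c)) = a · b · c⁻²` through `Circle.toUnits`. [folklore] -/
theorem isotropyDetChar_diagK (a b c : Circle) :
    isotropyDetChar (diagK a b c) = Circle.toUnits a * Circle.toUnits b * (Circle.toUnits c ^ 2)⁻¹ := by
  apply Units.ext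
  rw [coe_isotropyDetChar_diagK, Units.val_mul, Units.val_mul, Units.val_inv_eq_inv_val, Units.val_pow_eq_pow_val,
    Circle.toUnits_apply, Circle.toUnits_apply, Circle.toUnits_apply, Units.val_mk0, Units.val_mk0, Units.val_mk0,
    div_eq_mul_inv]

/-- On the first torus coordinate `diag(z,1,1)`, `κ` is `z` (weight `1`). [folklore] -/
theorem coe_isotropyDetChar_diagK_fst (z : Circle) : (isotropyDetChar (diagK z 1 1) : ℂ) = z := by
  rw [coe_isotropyDetChar_diagK, Circle.coe_one, mul_one, one_pow, div_one]

/-- On the last torus coordinate `diag(1,1,z)`, `κ` is `z⁻²` (weight `-2`). [folklore] -/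
theorem coe_isotropyDetChar_diagK_last (z : Circle) : (isotropyDetChar (diagK 1 1 z) : ℂ) = ((z : ℂ) ^ 2)⁻¹ := by
  rw [coe_isotropyDetChar_diagK, Circle.coe_one, mul_one, one_div]

/-! ### Appended: the isotropy representation on `𝔭₊` itself — torus weights `(1,0;-1)`, `(0,1;-1)`

The Jacobian cocycle `Jac` (the isotropy representation of `K` on the holomorphic tangent space `𝔭₊ ≅ ℂ²` at `x₀`,
and the automorphy factor of holomorphic ONE-forms, `holFormPullback₁`) evaluated on the diagonal torus is the diagonal
matrix `diag(a c⁻¹, b c⁻¹)`: the two weights of the `K`-type `𝔭₊` are `(1,0;-1)` and `(0,1;-1)`, whose sum is the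
weight `(1,1;-2)` of `∧²𝔭₊` above. -/

/-- **`D(diag(a,b,c))(x₀) = diag(a/c, b/c)`**: the isotropy representation on `𝔭₊` has torus weights `(1,0;-1)`
and `(0,1;-1)`. [folklore] -/
theorem Jac_diagU_x₀ (a b c : Circle) :
    Jac (diagU a b c) x₀ = Matrix.diagonal ![(a : ℂ) / c, (b : ℂ) / c] := by
  have hc : (c : ℂ) ≠ 0 := Circle.coe_ne_zero c
  ext i j
  simp only [Jac, Matrix.of_apply, W3_diagU_x₀, mat_diagU]
  fin_cases i <;> fin_cases j <;> simp [diagMat3, Matrix.diagonal] <;> field_simp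

/-- Entrywise: `D(diag(a,b,c))(x₀)_{00} = a/c`, `_{11} = b/c`, off-diagonal `0`. [folklore] -/
theorem Jac_diagK_x₀ (a b c : Circle) :
    Jac (diagK a b c : U21) x₀ = Matrix.diagonal ![(a : ℂ) / c, (b : ℂ) / c] :=
  Jac_diagU_x₀ a b c

/-- Consistency: the determinant of the `𝔭₊`-weights is the `∧²𝔭₊`-weight, `(a/c)(b/c) = a b / c²`. [folklore] -/
theorem det_Jac_diagU_x₀ (a b c : Circle) : (Jac (diagU a b c) x₀).det = (a : ℂ) * b / (c : ℂ) ^ 2 := by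
  rw [Jac_diagU_x₀, Matrix.det_diagonal, Fin.prod_univ_two]
  simp only [Matrix.cons_val_zero, Matrix.cons_val_one]
  have hc : (c : ℂ) ≠ 0 := Circle.coe_ne_zero c
  field_simp

end BallModel

end Literature.Geometry.ComplexHyperbolic

end
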